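import Literature.MathematicalPhysics.QuantumFieldTheory.Balaban1983to89.T4PathMeanHybrid

/-!
# NE7, ROAD P4 (law-level / second-moment lineage), FILE 1 of 2: the law-sequence SOCKET
# (TV rate, mean hybrid, term-wise socket, kinds, the U5c dictionary) over an ABSTRACT sequence of laws

(Cell `pub-balaban`, rung (B)+1 sub-cell `t4`, binder row NE7 = node U5 «matching modulo constants, Σ_K δ_K < ∞»,
co-owner #4 `b2b-balaban-t4-ne7-p4`, ROUND-2 skeleton-first mandate; companion record
`HOME/t4/skeletons/NE7-t4-ne7-p4.md`; file 2 = `NE7LawLevelAssembly` (NODE Q + the END).  New cell work ⇒ placed under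
`Summits/…` (placement rule 2026-08-19).)

HONEST FRAMING (T4-DAG PAGE 1).  Rung (B)+1 = existence AND uniqueness of the `ε = L^{-K} → 0` limit of unit-scale
averaged gauge-invariant expectations on ONE FIXED finite four-torus, CONDITIONAL on `BetaPertH` and the cell's nine
spine estimates (0/9 proved).  NOT infinite volume, NOT a mass gap, NOT the Clay problem.  NE7 is NOT PRINTED
([Balaban1989LargeFieldII] p. 356 defers expectation values) and is NOT proved here: every `def … : Prop` below is a
HYPOTHESIS SHAPE over abstract carriers, every theorem is [folklore] measure theory / finite sums, sorry-free.  No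
statement of the audited series is asserted or used; `BetaPertH`, (B), (B^μ) enter no declaration.  Value = the
kernel-checked COMPOSITION of the road's leaves; NOT summit progress.

THE ROAD (second-moment lineage t4-ne7-p3 → p4).  The variance / coupling route compares the two runs' LAWS of the
unit-lattice field, not `log Z(t)`.  Pursued to its producer (t4-ne7-p3 gens 1–10: transport ⇐ second moment ⇐ tilt ⇐
secant ⇐ hybrid-in-the-mean; tree `T4VarianceMatching`, `T4PathVarianceRate`, `T4PathMeanHybrid`), its weakest
law-level input is the MEAN HYBRID: a term-wise two-sided sandwich for the GOOD class of Bałaban's term densities,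
pointwise in the unit-lattice field and SOURCE-FREE (t = 0), plus the GLOBAL bad-class weights of each run at t = 0.
Road P4 adds the one structural fact the law currency must respect: Bałaban's densities are `(ℝT)^K ρ₀`, the law `ν K`
of the endpoint of a MARKOV CHAIN (averaging `T`, then the mass-preserving fibre resampling `ℝ`, [Balaban1989LargeFieldI]
(0.3)/(0.4) p. 176 — quoted verbatim in the header of `T4PathwiseCoupling`), NOT the push-forward `(avg^K)_* μ` of the
Wilson measure; the laws are therefore carried as an ABSTRACT sequence `ν : ℕ → Measure X` (this file), and the true
expectations are read through conditional dressing means (file 2, NODE Q).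

WHAT IS PROVED HERE (sections):
§1 `TVSeq`, `MeanHybridSeq`; `tvSeq_of_meanHybridSeq` (the mean-defect tilt lemma of `T4PathMeanHybrid` §1 by name) —
   NODE K, law half; `meanHybridSeq_effLaw_iff` (the cell's `EffMeanHybrid` is the `effLaw` instance, definitional).
§2 `TermMeanHybridSeq` (term densities, good class, single-run cores, tilt relation, mean weights) ⇒ `MeanHybridSeq`
   (proof adapted from `T4PathMeanHybrid.effMeanHybrid_of_effTermMeanHybrid`, whose statement is tied to `effLaw`).
§3 NODE S at density level, one integration short: factor-wise sandwiches per KIND on a synchronised pending integral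
   multiply and integrate to the term sandwich with radius `totalRadius kinds ρ K = Σ_i ρ_i K`
   (`termSandwich_of_factorSandwich`, by `T4HybridMatching.prod_sandwich` + `integral_sandwich` — the (1.73)–(1.75)
   mechanism of [Balaban1989LargeFieldII] p. 380 in abstract form); `summable_totalRadius`.
§4 NODE W: the mean bad fractions ARE node U5c's Z-level relative weights at source zero (`T4PathMeanHybrid` §4
   dictionary by name), restated for the normalised density laws `normLawOf`.
Deliberately NOT here: any producer of the leaves for Bałaban's data (rows NE2/NE3/NE5/NE9/NE4 rates, B14 (2.43)/(2.44)
sizes, NE7b/NE7c weights — NOT PRINTED as two-run statements; see the companion record).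
-/

noncomputable section

open MeasureTheory

namespace Summit.QuantumFields.BalabanUV.T4Continuum.NE7LawLevel

open Literature.MathematicalPhysics.QuantumFieldTheory.Balaban1983to89
open T4PathMeanHybrid T4MaximalCoupling T4HybridMatching T4VarianceMatching Missing
/-! ## §1 Law sequences: the TV rate, the mean hybrid, TV from the mean hybrid (NODE K, law half) -/

section LawSeq

variable {X : Type*} [MeasurableSpace X]

/-- ONE-SIDED TOTAL-VARIATION RATE of a sequence of (probability) laws: `ν_K(A) ≤ ν_{K+1}(A) + t_K` for every
measurable `A` (for probability laws the two-sided bound follows by complements).  Hypothesis shape; for Bałaban's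
ℝ-laws NOT PRINTED. [folklore] -/
def TVSeq (ν : ℕ → Measure X) (t : ℕ → ℝ) : Prop :=
  ∀ K, 0 ≤ t K ∧ ∀ A : Set X, MeasurableSet A → ν K A ≤ ν (K + 1) A + ENNReal.ofReal (t K)

/-- THE MEAN HYBRID over a law sequence (`T4PathMeanHybrid.EffMeanHybrid` with the effective laws replaced by an
abstract sequence `ν`): `ν_{K+1}` is the Gibbs tilt of `ν_K` by a measurable `f_K`, the sandwich
`e^{c−r}(1 − β) ≤ e^{f} ≤ e^{c+r}/(1 − β')` holds DEFECTIVELY at every field, and the defects have means `≤ W_K`,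
`≤ W'_K` under the runs' OWN laws.  Hypothesis shape, NOT PRINTED. [folklore] -/
def MeanHybridSeq (ν : ℕ → Measure X) (r W W' : ℕ → ℝ) : Prop :=
  ∀ K, ∃ (f β β' : X → ℝ) (c : ℝ), Measurable f ∧ Measurable β ∧ Measurable β' ∧ 0 ≤ r K ∧
    (∀ u, 0 ≤ β u ∧ β u ≤ 1) ∧ (∀ u, 0 ≤ β' u ∧ β' u ≤ 1) ∧
    (∀ u, Real.exp (c - r K) * (1 - β u) ≤ Real.exp (f u)) ∧
    (∀ u, Real.exp (f u) * (1 - β' u) ≤ Real.exp (c + r K)) ∧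
    ν (K + 1) = (ν K).tilted f ∧
    ∫ u, β u ∂(ν K) ≤ W K ∧ ∫ u, β' u ∂(ν (K + 1)) ≤ W' K

/-- The mean hybrid's inputs are nonnegative. [folklore] -/
theorem MeanHybridSeq.signBounds {ν : ℕ → Measure X} {r W W' : ℕ → ℝ} (h : MeanHybridSeq ν r W W') (K : ℕ) :
    0 ≤ r K ∧ 0 ≤ W K ∧ 0 ≤ W' K := by
  obtain ⟨f, β, β', c, -, -, -, hr, hβb, hβ'b, -, -, -, hW, hW'⟩ := h K
  exact ⟨hr, le_trans (integral_nonneg fun u => (hβb u).1) hW, le_trans (integral_nonneg fun u => (hβ'b u).1) hW'⟩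

/-- **NODE K (law half): the mean hybrid gives the TV rate `2 r_K + W_K + W'_K`** — the mean-defect tilt lemma
`T4PathMeanHybrid.measure_le_tilted_add_of_meanDefect` by name (Markov step, no range of `f`, no `W < 1`). [folklore] -/
theorem tvSeq_of_meanHybridSeq {ν : ℕ → Measure X} [hν : ∀ K, IsProbabilityMeasure (ν K)] {r W W' : ℕ → ℝ}
    (h : MeanHybridSeq ν r W W') : TVSeq ν (meanHybridRate r W W') := by
  intro K
  obtain ⟨f, β, β', c, hf, hβm, hβ'm, hr, hβb, hβ'b, hlow, hup, heq, hW, hW'⟩ := h K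
  have hK1 := hν (K + 1)
  have hfi : Integrable (fun u => Real.exp (f u)) (ν K) := by
    by_contra hni
    have h0 : ν (K + 1) = 0 := by rw [heq]; exact tilted_of_not_integrable hni
    have h1 := hK1.measure_univ
    rw [h0] at h1
    simp at h1
  have hW0 : 0 ≤ W K := le_trans (integral_nonneg fun u => (hβb u).1) hW
  have hW'0 : 0 ≤ W' K := le_trans (integral_nonneg fun u => (hβ'b u).1) hW'
  refine ⟨meanHybridRate_nonneg hr hW0 hW'0, fun A hA => ?_⟩
  rw [heq] at hW' ⊢
  exact measure_le_tilted_add_of_meanDefect hfi hβm hβ'm hβb hβ'b hr hlow hup hW hW' hA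

/-- For comparison: along a unit factorisation the cell's `EffMeanHybrid` IS `MeanHybridSeq` of the effective laws
(definitional). [folklore] -/
theorem meanHybridSeq_effLaw_iff {G O : Type*} {S : TorusScheme G O} [MeasurableSpace G] [GaugeGroup G]
    [HaarData G] [RegularGaugeGroup G] (F : T4VarianceMatching.UnitFactorisation S X) (r W W' : ℕ → ℝ) :
    MeanHybridSeq F.effLaw r W W' ↔ EffMeanHybrid F r W W' := Iff.rfl

end LawSeq

/-! ## §2 The term-wise socket over a law sequence (NODES S + D + W feed it) -/

section TermSeq

variable {X : Type*} [MeasurableSpace X]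

/-- THE TERM-WISE MEAN HYBRID over a law sequence (`T4PathMeanHybrid.EffTermMeanHybrid` with `effLaw ↦ ν`): per `K`,
finite term labels `T`, a field-INDEPENDENT good class `Gd ⊆ T`, measurable nonnegative term DENSITIES `a τ, b τ` of
the two runs with everywhere-positive totals, single-run cores `Sa, Sb`, a constant `c`, a radius `0 ≤ r K`; the LOWER
term sandwich on run A's core, the UPPER on run B's core; the tilt relation between the two laws; and the two MEAN
bounds (bad fraction + own core-complement mass ≤ `W K`, resp. `W' K`).  Hypothesis shape, NOT PRINTED. [folklore] -/
def TermMeanHybridSeq (ν : ℕ → Measure X) (r W W' : ℕ → ℝ) : Prop :=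
  ∀ K, ∃ (T Gd : Finset ℕ) (a b : ℕ → X → ℝ) (c : ℝ) (Sa Sb : Set X),
    Gd ⊆ T ∧ (∀ τ ∈ T, Measurable (a τ)) ∧ (∀ τ ∈ T, Measurable (b τ)) ∧ MeasurableSet Sa ∧ MeasurableSet Sb ∧
    0 ≤ r K ∧ (∀ u, ∀ τ ∈ T, 0 ≤ a τ u) ∧ (∀ u, ∀ τ ∈ T, 0 ≤ b τ u) ∧
    (∀ u, 0 < ∑ τ ∈ T, a τ u) ∧ (∀ u, 0 < ∑ τ ∈ T, b τ u) ∧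
    (∀ u ∈ Sa, ∀ τ ∈ Gd, Real.exp (c - r K) * a τ u ≤ b τ u) ∧
    (∀ u ∈ Sb, ∀ τ ∈ Gd, b τ u ≤ Real.exp (c + r K) * a τ u) ∧
    ν (K + 1) = (ν K).tilted (fun u => Real.log (∑ τ ∈ T, b τ u) - Real.log (∑ τ ∈ T, a τ u)) ∧
    ∫ u, (∑ τ ∈ T \ Gd, a τ u) / (∑ τ ∈ T, a τ u) ∂(ν K) + (ν K).real Saᶜ ≤ W K ∧
    ∫ u, (∑ τ ∈ T \ Gd, b τ u) / (∑ τ ∈ T, b τ u) ∂(ν (K + 1)) + (ν (K + 1)).real Sbᶜ ≤ W' K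

/-- **Term-wise socket ⇒ mean hybrid with the SAME `(r, W, W')`** (defects `1 − 1_{Sa}·good fraction`,
`1 − 1_{Sb}·good fraction`).  Proof adapted verbatim from `T4PathMeanHybrid.effMeanHybrid_of_effTermMeanHybrid`
(t4-ne7-p3 gen 10), whose statement is tied to `effLaw`. [folklore] -/
theorem meanHybridSeq_of_termMeanHybridSeq {ν : ℕ → Measure X} [hν : ∀ K, IsProbabilityMeasure (ν K)]
    {r W W' : ℕ → ℝ} (h : TermMeanHybridSeq ν r W W') : MeanHybridSeq ν r W W' := by
  intro K
  obtain ⟨T, Gd, a, b, c, Sa, Sb, hGd, ham, hbm, hSa, hSb, hr, ha0, hb0, hA, hB, hlow, hup, heq, hW, hW'⟩ := h K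
  haveI := hν K
  haveI := hν (K + 1)
  set gA : X → ℝ := fun u => (∑ τ ∈ Gd, a τ u) / ∑ τ ∈ T, a τ u with hgA
  set gB : X → ℝ := fun u => (∑ τ ∈ Gd, b τ u) / ∑ τ ∈ T, b τ u with hgB
  have hAm : Measurable fun u => ∑ τ ∈ T, a τ u := Finset.measurable_sum T ham
  have hBm : Measurable fun u => ∑ τ ∈ T, b τ u := Finset.measurable_sum T hbm
  have hgAm : Measurable gA := (Finset.measurable_sum Gd fun τ hτ => ham τ (hGd hτ)).div hAm
  have hgBm : Measurable gB := (Finset.measurable_sum Gd fun τ hτ => hbm τ (hGd hτ)).div hBm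
  have hgAb : ∀ u, 0 ≤ gA u ∧ gA u ≤ 1 := fun u =>
    ⟨div_nonneg (Finset.sum_nonneg fun τ hτ => ha0 u τ (hGd hτ)) (hA u).le,
      (div_le_one (hA u)).mpr (Finset.sum_le_sum_of_subset_of_nonneg hGd fun τ hτ _ => ha0 u τ hτ)⟩
  have hgBb : ∀ u, 0 ≤ gB u ∧ gB u ≤ 1 := fun u =>
    ⟨div_nonneg (Finset.sum_nonneg fun τ hτ => hb0 u τ (hGd hτ)) (hB u).le,
      (div_le_one (hB u)).mpr (Finset.sum_le_sum_of_subset_of_nonneg hGd fun τ hτ _ => hb0 u τ hτ)⟩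
  obtain ⟨hβm, hβb, hβI⟩ := meanDefect_core (μ := ν K) hgAm hgAb hSa
  obtain ⟨hβ'm, hβ'b, hβ'I⟩ := meanDefect_core (μ := ν (K + 1)) hgBm hgBb hSb
  have hbadA : ∀ u, (∑ τ ∈ T \ Gd, a τ u) / (∑ τ ∈ T, a τ u) = 1 - gA u := fun u => by
    rw [hgA, eq_sub_iff_add_eq, ← add_div, Finset.sum_sdiff hGd, div_self (hA u).ne']
  have hbadB : ∀ u, (∑ τ ∈ T \ Gd, b τ u) / (∑ τ ∈ T, b τ u) = 1 - gB u := fun u => by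
    rw [hgB, eq_sub_iff_add_eq, ← add_div, Finset.sum_sdiff hGd, div_self (hB u).ne']
  simp_rw [hbadA] at hW
  simp_rw [hbadB] at hW'
  have hexp : ∀ u, Real.exp (Real.log (∑ τ ∈ T, b τ u) - Real.log (∑ τ ∈ T, a τ u)) =
      (∑ τ ∈ T, b τ u) / ∑ τ ∈ T, a τ u := fun u => by
    rw [Real.exp_sub, Real.exp_log (hB u), Real.exp_log (hA u)]
  refine ⟨fun u => Real.log (∑ τ ∈ T, b τ u) - Real.log (∑ τ ∈ T, a τ u), fun u => 1 - Sa.indicator gA u,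
    fun u => 1 - Sb.indicator gB u, c, hBm.log.sub hAm.log, hβm, hβ'm, hr, hβb, hβ'b, fun u => ?_, fun u => ?_, heq,
    hβI.trans hW, hβ'I.trans hW'⟩
  · simp only [sub_sub_cancel, hexp]
    by_cases hu : u ∈ Sa
    · rw [Set.indicator_of_mem hu]
      exact (ratio_bounds_of_goodClass hGd (ha0 u) (hb0 u) (hA u) (hB u)).1 (hlow u hu)
    · rw [Set.indicator_of_notMem hu, mul_zero]
      exact div_nonneg (hB u).le (hA u).le
  · simp only [sub_sub_cancel, hexp]
    by_cases hu : u ∈ Sb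
    · rw [Set.indicator_of_mem hu]
      exact (ratio_bounds_of_goodClass hGd (ha0 u) (hb0 u) (hA u) (hB u)).2 (hup u hu)
    · rw [Set.indicator_of_notMem hu, mul_zero]
      exact (Real.exp_pos _).le

/-- Term-wise socket ⇒ TV rate `2r + W + W'`. [folklore] -/
theorem tvSeq_of_termMeanHybridSeq {ν : ℕ → Measure X} [∀ K, IsProbabilityMeasure (ν K)] {r W W' : ℕ → ℝ}
    (h : TermMeanHybridSeq ν r W W') : TVSeq ν (meanHybridRate r W W') :=
  tvSeq_of_meanHybridSeq (meanHybridSeq_of_termMeanHybridSeq h)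

end TermSeq

/-! ## §3 NODE S at density level: factor-wise sandwiches per KIND ⇒ the term sandwich, one integration short -/

section Kinds

variable {κ : Type*}

/-- The TOTAL term-wise radius of the road: the sum over the finitely many KINDS (E-terms, main action, 𝐑-terms,
boundary terms, coupling mismatch (γ), pending large-field factors) of the per-kind two-run radii. [folklore] -/
def totalRadius (kinds : Finset κ) (ρ : κ → ℕ → ℝ) (K : ℕ) : ℝ := ∑ i ∈ kinds, ρ i K

/-- The total radius is nonnegative when every kind's radius is. [folklore] -/
theorem totalRadius_nonneg {kinds : Finset κ} {ρ : κ → ℕ → ℝ} (h : ∀ i ∈ kinds, ∀ K, 0 ≤ ρ i K) (K : ℕ) :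
    0 ≤ totalRadius kinds ρ K := Finset.sum_nonneg fun i hi => h i hi K

/-- **Summability of the total radius from the kinds** (`Σ_K Σ_i ρ_i K < ∞` iff each kind is summable; finitely many
kinds). [folklore] -/
theorem summable_totalRadius {kinds : Finset κ} {ρ : κ → ℕ → ℝ} (h : ∀ i ∈ kinds, Summable (ρ i)) :
    Summable (totalRadius kinds ρ) := by
  have : totalRadius kinds ρ = fun K => ∑ i ∈ kinds, ρ i K := rfl
  rw [this]
  exact summable_sum h

variable {Y : Type*} [MeasurableSpace Y]

/-- **NODE S, one integration short.**  A good term's two densities at a unit-lattice field `u` are PENDING INTEGRALS of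
products over the kinds of nonnegative factors against ONE inner measure `μ` (node U5a's synchronisation: same inner
domain and measure in both runs): `a = ∫ ∏_i φ_i dμ`, `b = ∫ ∏_i ψ_i dμ`.  If every kind is sandwiched pointwise in the
inner variable, `e^{c_i − ρ_i} φ_i ≤ ψ_i ≤ e^{c_i + ρ_i} φ_i` (vanishing factors allowed — synchronised characteristic
functions are the case `c_i = ρ_i = 0`), then the term densities are sandwiched with constant `Σ c_i` and radius
`Σ ρ_i`:  `e^{Σc − Σρ} a ≤ b ≤ e^{Σc + Σρ} a`.  (`T4HybridMatching.prod_sandwich` then `integral_sandwich`; the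
(1.73)–(1.75) mechanism of [Balaban1989LargeFieldII] p. 380 in abstract form.) [folklore] -/
theorem termSandwich_of_factorSandwich (kinds : Finset κ) {μ : Measure Y} {φ ψ : κ → Y → ℝ} {c ρ : κ → ℝ}
    (hφ : ∀ y, ∀ i ∈ kinds, 0 ≤ φ i y)
    (hl : ∀ y, ∀ i ∈ kinds, Real.exp (c i - ρ i) * φ i y ≤ ψ i y)
    (hu : ∀ y, ∀ i ∈ kinds, ψ i y ≤ Real.exp (c i + ρ i) * φ i y)
    (hiφ : Integrable (fun y => ∏ i ∈ kinds, φ i y) μ) (hiψ : Integrable (fun y => ∏ i ∈ kinds, ψ i y) μ) :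
    Real.exp ((∑ i ∈ kinds, c i) - ∑ i ∈ kinds, ρ i) * ∫ y, ∏ i ∈ kinds, φ i y ∂μ ≤ ∫ y, ∏ i ∈ kinds, ψ i y ∂μ ∧
      ∫ y, ∏ i ∈ kinds, ψ i y ∂μ ≤ Real.exp ((∑ i ∈ kinds, c i) + ∑ i ∈ kinds, ρ i) * ∫ y, ∏ i ∈ kinds, φ i y ∂μ := by
  have hpt := fun y => prod_sandwich kinds (φ := fun i => φ i y) (ψ := fun i => ψ i y) (c := c) (r := ρ)
    (hφ y) (hl y) (hu y)
  exact integral_sandwich hiφ hiψ (ae_of_all _ fun y => (hpt y).1) (ae_of_all _ fun y => (hpt y).2)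

/-- The same read as the two one-sided clauses of `TermMeanHybridSeq` for ONE term at ONE field, with the road's
bookkeeping `c := Σ c_i`, `r := totalRadius kinds ρ K`. [folklore] -/
theorem termSandwich_of_factorSandwich' (kinds : Finset κ) {μ : Measure Y} {φ ψ : κ → Y → ℝ} {c : κ → ℝ}
    {ρ : κ → ℕ → ℝ} {K : ℕ} (hφ : ∀ y, ∀ i ∈ kinds, 0 ≤ φ i y)
    (hl : ∀ y, ∀ i ∈ kinds, Real.exp (c i - ρ i K) * φ i y ≤ ψ i y)
    (hu : ∀ y, ∀ i ∈ kinds, ψ i y ≤ Real.exp (c i + ρ i K) * φ i y)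
    (hiφ : Integrable (fun y => ∏ i ∈ kinds, φ i y) μ) (hiψ : Integrable (fun y => ∏ i ∈ kinds, ψ i y) μ) :
    Real.exp ((∑ i ∈ kinds, c i) - totalRadius kinds ρ K) * ∫ y, ∏ i ∈ kinds, φ i y ∂μ ≤
        ∫ y, ∏ i ∈ kinds, ψ i y ∂μ ∧
      ∫ y, ∏ i ∈ kinds, ψ i y ∂μ ≤
        Real.exp ((∑ i ∈ kinds, c i) + totalRadius kinds ρ K) * ∫ y, ∏ i ∈ kinds, φ i y ∂μ :=
  termSandwich_of_factorSandwich kinds (ρ := fun i => ρ i K) hφ hl hu hiφ hiψ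

end Kinds

/-! ## §4 NODE W: the mean bad fraction is node U5c's Z-level relative weight at source zero -/

section Weights

variable {X : Type*} [MeasurableSpace X]

/-- THE NORMALISED DENSITY LAW of a positive density `A` against a reference measure `vol`
(`(∫A)⁻¹ · A·vol`). [folklore] -/
def normLawOf (vol : Measure X) (A : X → ℝ) : Measure X :=
  (ENNReal.ofReal (∫ x, A x ∂vol))⁻¹ • vol.withDensity fun x => ENNReal.ofReal (A x)

/-- **NODE W (run A).**  If the law `ν K` is the normalised density law of the total `Σ_T a_τ` and the Z-level term
weights at source zero are the integrated densities, then node U5c's EXISTING output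
`T4WeightBudget.RelWeightBound l₀ T A B Bad W` (clause `bad_left` at `t = 0`) gives the run-A mean bad fraction
`≤ W K`. (`T4PathMeanHybrid.integral_badFraction_le_of_relWeightBound` by name.) [folklore] -/
theorem meanBadFraction_le_left {ι : Type*} [DecidableEq ι] {l₀ : ℝ} (hl₀ : 0 ≤ l₀) {T : ℕ → Finset ι}
    {A B : ℕ → ℝ → ι → ℝ} {Bad : ℕ → ℝ → Finset ι} {W : ℕ → ℝ}
    (hRW : T4WeightBudget.RelWeightBound l₀ T A B Bad W) (K : ℕ) (vol : Measure X) {a : ι → X → ℝ}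
    (ham : ∀ τ ∈ T K, Measurable (a τ)) (hpos : ∀ x, 0 < ∑ τ ∈ T K, a τ x)
    (hai : ∀ τ ∈ T K, Integrable (a τ) vol) (hZ : 0 < ∑ τ ∈ T K, ∫ x, a τ x ∂vol)
    (hAK : ∀ τ ∈ T K, A K 0 τ = ∫ x, a τ x ∂vol) :
    ∫ x, (∑ τ ∈ Bad K 0, a τ x) / (∑ τ ∈ T K, a τ x) ∂(normLawOf vol fun x => ∑ τ ∈ T K, a τ x) ≤ W K :=
  integral_badFraction_le_of_relWeightBound hl₀ hRW K vol ham hpos hai hZ hAK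

/-- **NODE W (run B)**, clause `bad_right` at `t = 0`. [folklore] -/
theorem meanBadFraction_le_right {ι : Type*} [DecidableEq ι] {l₀ : ℝ} (hl₀ : 0 ≤ l₀) {T : ℕ → Finset ι}
    {A B : ℕ → ℝ → ι → ℝ} {Bad : ℕ → ℝ → Finset ι} {W : ℕ → ℝ}
    (hRW : T4WeightBudget.RelWeightBound l₀ T A B Bad W) (K : ℕ) (vol : Measure X) {b : ι → X → ℝ}
    (hbm : ∀ τ ∈ T K, Measurable (b τ)) (hpos : ∀ x, 0 < ∑ τ ∈ T K, b τ x)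
    (hbi : ∀ τ ∈ T K, Integrable (b τ) vol) (hZ : 0 < ∑ τ ∈ T K, ∫ x, b τ x ∂vol)
    (hBK : ∀ τ ∈ T K, B K 0 τ = ∫ x, b τ x ∂vol) :
    ∫ x, (∑ τ ∈ Bad K 0, b τ x) / (∑ τ ∈ T K, b τ x) ∂(normLawOf vol fun x => ∑ τ ∈ T K, b τ x) ≤ W K :=
  integral_badFraction_le_of_relWeightBound_right hl₀ hRW K vol hbm hpos hbi hZ hBK

end Weights

end Summit.QuantumFields.BalabanUV.T4Continuum.NE7LawLevel

end
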